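import Literature.Computability.QuantumComplexity.GeneratedOracleSubst
import Literature.Computability.QuantumComplexity.GeneratedCircuitsSolvable
import HarnessLib

/-!
# Search problems solved by polynomial-time generated circuits WITH A `BQP` ORACLE are in `FBQP`

Topic `Literature/Computability/QuantumComplexity`; the assembly of `GeneratedOracleSubst.lean`
(`exists_generated_oracleFree`: Bennett–Bernstein–Brassard–Vazirani 1997, Cor. 4.15 `BQP^BQP = BQP`
for generated circuits — the oracle gates replaced by tidy blocks, the description again printed in
polynomial time) with `GeneratedCircuitsSolvable.lean` (`isQSolvable_of_generated_circuits`: the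
universal executor on the table of an oracle-free generated circuit, Nielsen–Chuang 2010, §4.5):

* **`isQSolvable_of_generated_oracle_circuits`**: if `A ∈ BQP`, `x ↦ (1^{k x}, rawGates (C x))` is
  computed on codes in polynomial time, every `C x` is a Clifford+`T` circuit on `k x ≥ 1` wires whose
  oracle gates query `A`, `post ∈ FP`, `Rel` is closed under extension of the output, and `C x` run
  WITH the oracle `A` on `|0…0⟩` and measured yields with probability `≥ 2/3 + δ` (`δ > 0`) a register
  content `f` with `post ⟨x, f⟩ ∈ Rel x`, then `IsQSolvable Rel`.

Everything is proved; no named fact is introduced.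

## References

* C. H. Bennett, E. Bernstein, G. Brassard, U. Vazirani, *Strengths and weaknesses of quantum
  computing*, SIAM J. Comput. 26 (1997) 1510–1523, §4 and Cor. 4.15 (`BQP^BQP = BQP`)
  [BennettBernsteinBrassardVazirani1997].
* M. A. Nielsen, I. L. Chuang, *Quantum Computation and Quantum Information*, CUP 2010, §4.5
  (uniform families: a classical computer outputs a description of the circuit) [NielsenChuang2010].
-/

noncomputable section

namespace Literature.Computability.QuantumComplexity

open _root_.Computability Complexity Complexity.CodeFP Cryptography UExec

variable {Rel : List Bool → Set (List Bool)} {k : List Bool → ℕ}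

/-- **Search problems solved by polynomial-time generated circuits with a `BQP` oracle are
`IsQSolvable`** (`BQP^BQP = BQP` for generated circuits). Let `A ∈ BQP`, let `C x` be a Clifford+`T`
circuit on `k x ≥ 1` wires, possibly with oracle gates (querying `A`), whose description
`(1^{k x}, rawGates (C x))` is computed from `x` in polynomial time, `post ∈ FP`, `Rel` closed under
extension of the output, and suppose that for every `x` the circuit `C x` run with the oracle `A` on
`|0…0⟩` and measured yields with probability `≥ 2/3 + δ` (`δ > 0`) a content `f` with
`post ⟨x, f⟩ ∈ Rel x`. Then `IsQSolvable Rel` (`exists_generated_oracleFree`, then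
`isQSolvable_of_generated_circuits`).
[cite: BennettBernsteinBrassardVazirani1997, Cor. 4.15 (BQP^BQP = BQP) with Thm. 4.13, Thm. 4.14]
[cite: NielsenChuang2010, §4.5 (uniform families written by a classical computer)] -/
theorem isQSolvable_of_generated_oracle_circuits {A : Language Bool} (hA : A ∈ BQP)
    (hR : ∀ x y z, y ∈ Rel x → y <+: z → z ∈ Rel x)
    (C : (x : List Bool) → QCircuit cliffordT (k x)) (hk : ∀ x, 1 ≤ k x)
    (hgen : CodeFP strE tcE fun x => (k x, (C x).rawGates))
    (post : List Bool → List Bool) (hpost : post ∈ FP) {δ : ℝ} (hδ : 0 < δ)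
    (hprob : ∀ x, 2 / 3 + δ ≤ (C x).probEvent A (basisState fun _ => false)
      {f | post (boolPair x (List.ofFn f)) ∈ Rel x}) :
    IsQSolvable Rel := by
  obtain ⟨k', C', post', hfree', hk', hgen', hpost', hprob'⟩ :=
    exists_generated_oracleFree (Rel := Rel) hA C hk hgen post hpost hδ hprob
  exact isQSolvable_of_generated_circuits hR C' hfree' hk' hgen' post' hpost' hprob'

end Literature.Computability.QuantumComplexity

end
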